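/-
Copyright (c) 2026. All rights reserved.
Released under Apache 2.0 license as described in the file LICENSE.
-/
import Summits.HodgeConjecture.HodgeConjecture.Theorems.K2E1SphericalEisensteinSolvesXSystemU2      -- ★ S2 (K2E3-p12): `iota_toHX_eq_toHN`, `memLp_zFun_of_iotaBound`, `continuous_borelHeight_cpow` (+ ★ P2b′, `zFun_add∕smul`)
import Summits.HodgeConjecture.HodgeConjecture.Theorems.K2E1SphericalEisensteinContinuationU2Final  -- ★ (Ξ₂)₂ IDENTIFIED `borelConstantTerm_sphericalEisenstein_cm_two` (K2E1-p09)
import Summits.HodgeConjecture.HodgeConjecture.Theorems.K2E1BLLiftIntegrabilityU                   -- ★ p859529 lift brick: `integrable_mul_lift`, `quotFun_lift`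
import Literature.NumberTheory.Automorphic.AutomorphicFormsL2OrbitalSmoothing                     -- ★ `continuous_integral_mul_inv_mul` (Folland 2.39)
import Mathlib.Topology.UrysohnsLemma
import Mathlib.MeasureTheory.Function.LocallyIntegrable
import Mathlib.Analysis.Meromorphic.Basic
import Mathlib.Analysis.InnerProductSpace.LinearMap
import HarnessLib

/-!
# «CLOSER₂ EXPORTS», FILE X2a — `K2E1SphericalEisensteinCoefficientCMTwo`: three small suppliers of the global export head

Track B ∕ K2-LIT, crux h413 = `stmt-HodgeConjecture-24833`, route of record `HCCMUnconditional`; cell `hodgecm-mathlib`, squad K2, ENGINE E1.  THEOREMS ONLY (no `def`, no `instance`,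
no `notation`, no `sorry`; default heartbeats); lane `--supports stmt-HodgeConjecture-24833 --as helper` (count-neutral).
WHAT (for FILE X2 `sphericalEisenstein_meromorphic_exports_cm_two`, clauses (E3)∕(E4)):
* §1 (generic complex analysis) `meromorphicAt_clm_apply` (a continuous linear map of a meromorphic germ is meromorphic) and **`meromorphicOn_coeff_of_system`**: if
  `A(v(z)) = φ₀•α₁(z) + cc(z)•α₂(z)` on a co-discrete `U ⊆ D` with `v` meromorphic on the open `D`, `α₁, α₂` holomorphic on `D` into a Hilbert space and `α₂ ≠ 0` on `D`, then the scalar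
  coefficient `cc` is MEROMORPHIC on `D` (pair the system with `⟪α₂(z₀), ·⟫`: `cc = (⟪α₂(z₀),A v⟫ − φ₀⟪α₂(z₀),α₁⟫)∕⟪α₂(z₀),α₂⟫` on a punctured neighbourhood of `z₀`) — the route from the
  B–L `α`-system of FILE X1 to the meromorphy of the constant-term coefficient [BernsteinLapid2019, §2.4, §4 Claim 4].
* §2 (generic rank) `locallyIntegrable_lift` and **`continuous_integral_mul_lift`**: for `U ∈ 𝓗_k(𝔛)` and `h ∈ C_c(G(𝔸))`, `g ↦ ∫ h(y)·U[(g y)⁻¹] dν_G(y)` is CONTINUOUS (★ lift brick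
  `integrable_mul_lift` + Urysohn ⇒ the lift is locally integrable; ★ `continuous_integral_mul_inv_mul` after `y = g⁻¹u`) — clause (E4) `Continuous (Ec z)` off the pole set.
* §3 (`U(1,1)_{L∕L⁺}`) **`cnstN_iota_toHX_eisensteinSeriesU_eq_smul_add_cm_two`**: ★ S2 `exists_cnstN_iota_toHX_eisensteinSeriesU_eq_cm_two` with the coefficient IDENTIFIED —
  `cnst_N(ι[Ẽ_z]) = φ₀•toHN(H^z) + (φ₀·c(z))•toHN(H^{1−z})`, `c(z) = ν(𝓕)⁻¹∫_{N(𝔸)} H(w₀v)^z dν(v)` (S2's proof verbatim on ★ (Ξ₂)₂ identified `borelConstantTerm_sphericalEisenstein_cm_two`)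
  — with FILE X1's `α`-system and `α₂(z) ≠ 0` it identifies X1's coefficient `cc = φ₀·c` on `U ∩ {1 < Re}` (clause (E3)).
HONEST LABEL: HC_CM is proved only modulo the 7 printed citations (2 remaining named inputs: hLiu418 = `stmt-HodgeConjecture-24832`, h413 = `stmt-HodgeConjecture-24833`) until rung 0
closes; this file asserts no named fact, closes no socket; count-neutral.
[cite: BernsteinLapid2019, §2.4 and §4 Claims 4–5 (p. 10)] [cite: MoeglinWaldspurger1995, I.2.6, II.1.7, IV.1.9] [cite: Folland1995, Prop. 2.39]

## References
* [BernsteinLapid2019] J. Bernstein, E. Lapid, *On the meromorphic continuation of Eisenstein series*, J. AMS 37 (2024), §2.4, §4.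
* [MoeglinWaldspurger1995] C. Mœglin, J.-L. Waldspurger, *Spectral decomposition and Eisenstein series* (1995), I.2.6, II.1.7, IV.1.9.
* [Folland1995] G. B. Folland, *A Course in Abstract Harmonic Analysis* (1995), Prop. 2.39.
-/

set_option autoImplicit false
set_option linter.dupNamespace false  -- the mandated namespace repeats the summit's segment (`HodgeConjecture.HodgeConjecture`)

noncomputable section

open MeasureTheory Measure Filter Topology Set NumberField
open scoped NNReal ENNReal ComplexConjugate InnerProductSpace
open Literature.MeasureTheory.Group Literature.NumberTheory Literature.NumberTheory.Automorphic Literature.NumberTheory.Automorphic.UnitaryGroup AdelicGroupData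
open Summit.HodgeConjecture.HodgeConjecture.Cruxes.H413.K2E1BorelEisensteinU
open Summit.HodgeConjecture.HodgeConjecture.Cruxes.H413.K2E1BLBorelSpacesU2Defs
open Summit.HodgeConjecture.HodgeConjecture.Cruxes.H413.K2E1BLBorelOperatorsU2Defs
open Summit.HodgeConjecture.HodgeConjecture.Cruxes.H413.K2E1BLConstantTermProjectionMeasurableU2 (cnstN_toHN_eq_toHN_borelConstantTerm')
open Summit.HodgeConjecture.HodgeConjecture.Cruxes.H413.K2E1BorelEisensteinRegularU (continuous_eisensteinSeriesU_flatSectionU_cm_two)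
open Summit.HodgeConjecture.HodgeConjecture.Cruxes.H413.K2E1SphericalEisensteinSolvesXSystemU2 (iota_toHX_eq_toHN memLp_zFun_of_iotaBound continuous_borelHeight_cpow eisensteinSeriesU_flatSectionU_quotientSubgroup_mul)
open Summit.HodgeConjecture.HodgeConjecture.Cruxes.H413.K2E1SphericalEisensteinContinuationU2Final (borelConstantTerm_sphericalEisenstein_cm_two)
open Summit.HodgeConjecture.HodgeConjecture.Cruxes.H413.K2E1BLLiftIntegrabilityU (integrable_mul_lift)

namespace Summit.HodgeConjecture.HodgeConjecture.Cruxes.H413.K2E1SphericalEisensteinCoefficientCMTwo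

/-! ## §1 Generic complex analysis: the coefficient of a vector system is meromorphic -/

section Generic

/-- A continuous linear map applied to a meromorphic germ is meromorphic (`(z−z₀)^n • A(v z) = A((z−z₀)^n • v z)`). [cite: BernsteinLapid2019, §2.1] -/
theorem meromorphicAt_clm_apply {𝓥 𝓦 : Type*} [NormedAddCommGroup 𝓥] [NormedSpace ℂ 𝓥] [NormedAddCommGroup 𝓦] [NormedSpace ℂ 𝓦]
    (A : 𝓥 →L[ℂ] 𝓦) {v : ℂ → 𝓥} {z₀ : ℂ} (hv : MeromorphicAt v z₀) : MeromorphicAt (fun s => A (v s)) z₀ := by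
  obtain ⟨n, hn⟩ := hv
  exact ⟨n, ((A.analyticAt _).comp hn).congr (Eventually.of_forall fun s => by simp only [Function.comp_apply, map_smul])⟩

/-- **THE COEFFICIENT OF A VECTOR SYSTEM IS MEROMORPHIC.**  `D` open, `U ⊆ D` co-discrete at every point of `D`; `v` meromorphic on `D` (values in a normed space), `A` a continuous
linear map into a Hilbert space `𝓦`, `α₁ α₂ : ℂ → 𝓦` holomorphic on `D` with `α₂ ≠ 0` on `D`; if `A(v z) = φ₀•α₁ z + cc z•α₂ z` for `z ∈ U` then `cc` is meromorphic on `D`: near `z₀`,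
`cc = (⟪α₂ z₀, A v⟫ − φ₀⟪α₂ z₀, α₁⟫)·⟪α₂ z₀, α₂⟫⁻¹` on a punctured neighbourhood (`⟪α₂ z₀, α₂ z₀⟫ ≠ 0` persists nearby), a meromorphic germ.
[cite: BernsteinLapid2019, §2.4 and §4 Claim 4 (p. 10)] -/
theorem meromorphicOn_coeff_of_system {𝓥 𝓦 : Type*} [NormedAddCommGroup 𝓥] [NormedSpace ℂ 𝓥] [NormedAddCommGroup 𝓦] [InnerProductSpace ℂ 𝓦] [CompleteSpace 𝓦]
    {D U : Set ℂ} (hD : IsOpen D) (hU : ∀ z₀ ∈ D, ∀ᶠ s in 𝓝[≠] z₀, s ∈ U)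
    (A : 𝓥 →L[ℂ] 𝓦) {v : ℂ → 𝓥} (hv : MeromorphicOn v D) {α₁ α₂ : ℂ → 𝓦} (hα₁ : DifferentiableOn ℂ α₁ D) (hα₂ : DifferentiableOn ℂ α₂ D)
    (hne : ∀ z ∈ D, α₂ z ≠ 0) (φ₀ : ℂ) {cc : ℂ → ℂ} (hsys : ∀ z ∈ U, A (v z) = φ₀ • α₁ z + cc z • α₂ z) :
    MeromorphicOn cc D := by
  intro z₀ hz₀
  have han₁ : AnalyticAt ℂ (fun s => innerSL ℂ (α₂ z₀) (α₁ s)) z₀ := ((innerSL ℂ (α₂ z₀)).analyticAt _).comp (hα₁.analyticAt (hD.mem_nhds hz₀))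
  have han₂ : AnalyticAt ℂ (fun s => innerSL ℂ (α₂ z₀) (α₂ s)) z₀ := ((innerSL ℂ (α₂ z₀)).analyticAt _).comp (hα₂.analyticAt (hD.mem_nhds hz₀))
  have hd0 : innerSL ℂ (α₂ z₀) (α₂ z₀) ≠ 0 := by rw [innerSL_apply_apply]; exact inner_self_ne_zero.2 (hne z₀ hz₀)
  have hev : ∀ᶠ s in 𝓝 z₀, innerSL ℂ (α₂ z₀) (α₂ s) ≠ 0 := han₂.continuousAt.eventually_ne hd0
  have h1 : MeromorphicAt (fun s => innerSL ℂ (α₂ z₀) (A (v s))) z₀ := meromorphicAt_clm_apply ((innerSL ℂ (α₂ z₀)).comp A) (hv z₀ hz₀)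
  have h2 : MeromorphicAt (fun s => φ₀ * innerSL ℂ (α₂ z₀) (α₁ s)) z₀ := (analyticAt_const.fun_mul han₁).meromorphicAt
  have h3 : MeromorphicAt (fun s => (innerSL ℂ (α₂ z₀) (α₂ s))⁻¹) z₀ := han₂.meromorphicAt.fun_inv
  refine ((h1.fun_sub h2).fun_mul h3).congr ?_
  filter_upwards [hU z₀ hz₀, mem_nhdsWithin_of_mem_nhds hev] with s hsU hs0
  have h := congrArg (innerSL ℂ (α₂ z₀)) (hsys s hsU)
  rw [map_add, map_smul, map_smul, smul_eq_mul, smul_eq_mul] at h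
  rw [h, add_sub_cancel_left, mul_inv_cancel_right₀ hs0]

end Generic

/-! ## §2 Generic rank: the convolution of a test function against the lift of a `𝓗_k(𝔛)`-vector is continuous in `g` -/

section Lift

variable {F E : Type} [Field F] [NumberField F] [Field E] [NumberField E] [Algebra F E] {c : E ≃ₐ[F] E} {N : ℕ} [NeZero N]
variable [MeasurableSpace (quasiSplit F E c N).Adelic] [BorelSpace (quasiSplit F E c N).Adelic]
variable (μ : Measure (quasiSplit F E c N).automorphicQuotient) [(quasiSplit F E c N).IsAutomorphicMeasure μ]
  (νG : Measure (quasiSplit F E c N).Adelic) [νG.IsHaarMeasure] [νG.IsInvInvariant]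

/-- **THE LIFT OF A `𝓗_k(𝔛)`-VECTOR IS LOCALLY INTEGRABLE**: `y ↦ U[y⁻¹]` is integrable on every compact `K ⊆ G(𝔸)` (★ lift brick `integrable_mul_lift` at `g = 1` against a Urysohn
function `= 1` on `K`). [cite: BernsteinLapid2019, §4 Claim 5 (p. 10)] [cite: Folland1995, Prop. 2.39] -/
theorem locallyIntegrable_lift (k : ℕ) {U : (quasiSplit F E c N).automorphicQuotient → ℂ}
    (hU : MemLp U 2 (μ.withDensity fun x => (((supHeight F E c N x)⁻¹ ^ (2 * k) : ℝ≥0) : ℝ≥0∞))) :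
    LocallyIntegrable (fun y => U ((quasiSplit F E c N).toAutomorphicQuotient y⁻¹)) νG := by
  haveI : T2Space (quasiSplit F E c N).Adelic := t2Space_quasiSplitAdelic
  haveI : LocallyCompactSpace (quasiSplit F E c N).Adelic := locallyCompactSpace_quasiSplitAdelic
  refine locallyIntegrable_iff.2 fun K hK => ?_
  obtain ⟨φ, hφ1, -, hφc, -⟩ := exists_continuous_one_zero_of_isCompact hK isClosed_empty (Set.disjoint_empty K)
  have hI := integrable_mul_lift μ νG k hU (h := fun y => ((φ y : ℝ) : ℂ)) (Complex.continuous_ofReal.comp φ.continuous) (hφc.comp_left Complex.ofReal_zero) 1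
  refine (hI.integrableOn (s := K)).congr_fun (fun y hy => ?_) hK.isClosed.measurableSet
  dsimp only; rw [one_mul, hφ1 hy, Pi.one_apply, Complex.ofReal_one, one_mul]

/-- **`g ↦ ∫ h(y)·U[(g y)⁻¹] dν_G(y)` IS CONTINUOUS** for `U ∈ 𝓗_k(𝔛)` and `h ∈ C_c(G(𝔸))`: substitute `y = g⁻¹u` (left invariance of the Haar measure) and apply ★
`continuous_integral_mul_inv_mul` to the locally integrable lift (§2). [cite: BernsteinLapid2019, §4 Claim 5 (p. 10)] [cite: Folland1995, Prop. 2.39] -/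
theorem continuous_integral_mul_lift (k : ℕ) {U : (quasiSplit F E c N).automorphicQuotient → ℂ}
    (hU : MemLp U 2 (μ.withDensity fun x => (((supHeight F E c N x)⁻¹ ^ (2 * k) : ℝ≥0) : ℝ≥0∞)))
    {h : (quasiSplit F E c N).Adelic → ℂ} (hh : Continuous h) (hhs : HasCompactSupport h) :
    Continuous fun g : (quasiSplit F E c N).Adelic => ∫ y, h y * U ((quasiSplit F E c N).toAutomorphicQuotient (g * y)⁻¹) ∂νG := by
  haveI : T2Space (quasiSplit F E c N).Adelic := t2Space_quasiSplitAdelic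
  haveI : LocallyCompactSpace (quasiSplit F E c N).Adelic := locallyCompactSpace_quasiSplitAdelic
  haveI : SecondCountableTopology (quasiSplit F E c N).Adelic := secondCountableTopology_quasiSplitAdelic
  refine (continuous_integral_mul_inv_mul νG hh hhs (locallyIntegrable_lift μ νG k hU)).congr fun g => ?_
  rw [← integral_mul_left_eq_self (fun u => h (g⁻¹ * u) * U ((quasiSplit F E c N).toAutomorphicQuotient u⁻¹)) g]
  exact integral_congr_ae (Eventually.of_forall fun y => by simp only [inv_mul_cancel_left])

end Lift

/-! ## §3 `U(1,1)_{L∕L⁺}`: (S2) with the coefficient identified -/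

section ConstantTerm

variable (L : Type) [Field L] [NumberField L] [IsCMField L]
variable [MeasurableSpace (quasiSplit (↥(maximalRealSubfield L)) L (IsCMField.complexConj L) 2).Adelic] [BorelSpace (quasiSplit (↥(maximalRealSubfield L)) L (IsCMField.complexConj L) 2).Adelic]

/-- **(S2) IDENTIFIED: `cnst_N(ι[Ẽ_z]) = φ₀•toHN(H^z) + (φ₀·c(z))•toHN(H^{1−z})`** on `U(1,1)_{L∕L⁺}` for `1 < Re z`, with THE intertwining scalar
`c(z) = ν(𝓕)⁻¹·∫_{N(𝔸)} H(w₀v)^z dν(v)` — ★ S2's proof verbatim, the pointwise constant term now read from ★ (Ξ₂)₂ identified `borelConstantTerm_sphericalEisenstein_cm_two`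
(`E_B(φ₀H^z)(g) = φ₀(H(g)^z + c(z)H(g)^{1−z})`). Letters as S2: `hb` (`IotaBound`), `hdis'` (fibre-average invariance of `wtm`), `hE`, `hα₁`, `hα₂`.
[cite: BernsteinLapid2019, §4 Claim 4 (p. 10), §7] [cite: MoeglinWaldspurger1995, I.2.6, II.1.7] -/
theorem cnstN_iota_toHX_eisensteinSeriesU_eq_smul_add_cm_two
    (ν : Measure ↥(adelicUnipotent (↥(maximalRealSubfield L)) L (IsCMField.complexConj L) 2)) [ν.IsHaarMeasure] [ν.IsMulRightInvariant]
    {𝓕 : Set ↥(adelicUnipotent (↥(maximalRealSubfield L)) L (IsCMField.complexConj L) 2)}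
    (h𝓕N : IsFundamentalDomain ↥(rationalUnipotent (↥(maximalRealSubfield L)) L (IsCMField.complexConj L) 2) 𝓕 ν) (h𝓕c : IsCompact (closure 𝓕))
    {μ : Measure (quasiSplit (↥(maximalRealSubfield L)) L (IsCMField.complexConj L) 2).automorphicQuotient} {k : ℕ} {a : ℝ≥0} {μZ : Measure (borelQuotient (↥(maximalRealSubfield L)) L (IsCMField.complexConj L) 2)} [IsFiniteMeasure (weightedTruncMeasure (↥(maximalRealSubfield L)) L (IsCMField.complexConj L) 2 k a μZ)]
    (hb : IotaBound (↥(maximalRealSubfield L)) L (IsCMField.complexConj L) 2 k a μ μZ)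
    (hdis' : ∀ Φ : (quasiSplit (↥(maximalRealSubfield L)) L (IsCMField.complexConj L) 2).Adelic → ℂ, Measurable Φ → (∀ b ∈ ratBorelSubgroup (↥(maximalRealSubfield L)) L (IsCMField.complexConj L) 2, ∀ g, Φ (b * g) = Φ g) →
      Integrable (zFun (↥(maximalRealSubfield L)) L (IsCMField.complexConj L) 2 Φ) (weightedTruncMeasure (↥(maximalRealSubfield L)) L (IsCMField.complexConj L) 2 k a μZ) → Integrable (zFun (↥(maximalRealSubfield L)) L (IsCMField.complexConj L) 2 (borelConstantTerm ν 𝓕 Φ)) (weightedTruncMeasure (↥(maximalRealSubfield L)) L (IsCMField.complexConj L) 2 k a μZ) →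
        ∫ x, zFun (↥(maximalRealSubfield L)) L (IsCMField.complexConj L) 2 (borelConstantTerm ν 𝓕 Φ) x ∂(weightedTruncMeasure (↥(maximalRealSubfield L)) L (IsCMField.complexConj L) 2 k a μZ) = ∫ x, zFun (↥(maximalRealSubfield L)) L (IsCMField.complexConj L) 2 Φ x ∂(weightedTruncMeasure (↥(maximalRealSubfield L)) L (IsCMField.complexConj L) 2 k a μZ))
    (φ₀ : ℂ) {z : ℂ} (hz : 1 < z.re) (hE : MemLp ((quasiSplit (↥(maximalRealSubfield L)) L (IsCMField.complexConj L) 2).quotFun (eisensteinSeriesU (flatSectionU (fun _ : (quasiSplit (↥(maximalRealSubfield L)) L (IsCMField.complexConj L) 2).Adelic => φ₀) z))) 2 (μ.withDensity fun x => (((supHeight (↥(maximalRealSubfield L)) L (IsCMField.complexConj L) 2 x)⁻¹ ^ (2 * k) : ℝ≥0) : ℝ≥0∞)))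
    (hα₁ : MemLp (zFun (↥(maximalRealSubfield L)) L (IsCMField.complexConj L) 2 (fun g : (quasiSplit (↥(maximalRealSubfield L)) L (IsCMField.complexConj L) 2).Adelic => (((borelHeight g : ℝ)) : ℂ) ^ z)) 2 (weightedTruncMeasure (↥(maximalRealSubfield L)) L (IsCMField.complexConj L) 2 k a μZ))
    (hα₂ : MemLp (zFun (↥(maximalRealSubfield L)) L (IsCMField.complexConj L) 2 (fun g : (quasiSplit (↥(maximalRealSubfield L)) L (IsCMField.complexConj L) 2).Adelic => (((borelHeight g : ℝ)) : ℂ) ^ (1 - z))) 2 (weightedTruncMeasure (↥(maximalRealSubfield L)) L (IsCMField.complexConj L) 2 k a μZ)) :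
    cnstN (↥(maximalRealSubfield L)) L (IsCMField.complexConj L) 2 k a μZ (iota hb (toHX (↥(maximalRealSubfield L)) L (IsCMField.complexConj L) 2 k μ (eisensteinSeriesU (flatSectionU (fun _ : (quasiSplit (↥(maximalRealSubfield L)) L (IsCMField.complexConj L) 2).Adelic => φ₀) z)) hE)) =
      φ₀ • toHN (↥(maximalRealSubfield L)) L (IsCMField.complexConj L) 2 k a μZ (fun g : (quasiSplit (↥(maximalRealSubfield L)) L (IsCMField.complexConj L) 2).Adelic => (((borelHeight g : ℝ)) : ℂ) ^ z) hα₁ +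
        (φ₀ * ((((ν 𝓕).toReal⁻¹ : ℝ)) : ℂ) * (∫ v : ↥(adelicUnipotent (↥(maximalRealSubfield L)) L (IsCMField.complexConj L) 2), (((borelHeight ((quasiSplit (↥(maximalRealSubfield L)) L (IsCMField.complexConj L) 2).toAdelic (weylLongU ((IsCMField.complexConj L : L ≃ₐ[↥(maximalRealSubfield L)] L) : L →+* L) (rfl : (StdForm.antidiagonal 2).over L = (StdForm.antidiagonal 2).over L)) * (v : (quasiSplit (↥(maximalRealSubfield L)) L (IsCMField.complexConj L) 2).Adelic)) : ℝ) : ℂ) ^ z) ∂ν)) • toHN (↥(maximalRealSubfield L)) L (IsCMField.complexConj L) 2 k a μZ (fun g : (quasiSplit (↥(maximalRealSubfield L)) L (IsCMField.complexConj L) 2).Adelic => (((borelHeight g : ℝ)) : ℂ) ^ (1 - z)) hα₂ := by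
  -- the pointwise constant term, identified (★ (Ξ₂)₂)
  have hct : borelConstantTerm ν 𝓕 (eisensteinSeriesU (flatSectionU (fun _ : (quasiSplit (↥(maximalRealSubfield L)) L (IsCMField.complexConj L) 2).Adelic => φ₀) z)) =
      φ₀ • (fun g : (quasiSplit (↥(maximalRealSubfield L)) L (IsCMField.complexConj L) 2).Adelic => (((borelHeight g : ℝ)) : ℂ) ^ z) + (φ₀ * ((((ν 𝓕).toReal⁻¹ : ℝ)) : ℂ) * (∫ v : ↥(adelicUnipotent (↥(maximalRealSubfield L)) L (IsCMField.complexConj L) 2), (((borelHeight ((quasiSplit (↥(maximalRealSubfield L)) L (IsCMField.complexConj L) 2).toAdelic (weylLongU ((IsCMField.complexConj L : L ≃ₐ[↥(maximalRealSubfield L)] L) : L →+* L) (rfl : (StdForm.antidiagonal 2).over L = (StdForm.antidiagonal 2).over L)) * (v : (quasiSplit (↥(maximalRealSubfield L)) L (IsCMField.complexConj L) 2).Adelic)) : ℝ) : ℂ) ^ z) ∂ν)) • (fun g : (quasiSplit (↥(maximalRealSubfield L)) L (IsCMField.complexConj L) 2).Adelic => (((borelHeight g : ℝ)) : ℂ)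 ^ (1 - z)) := by
    funext g
    rw [borelConstantTerm_sphericalEisenstein_cm_two L ν h𝓕N h𝓕c φ₀ hz g, Pi.add_apply, Pi.smul_apply, Pi.smul_apply, smul_eq_mul, smul_eq_mul]
    ring
  -- invariances and measurability of `E_z`
  have hφ := eisensteinSeriesU_flatSectionU_quotientSubgroup_mul L φ₀ z
  have hφB : ∀ γ ∈ ratBorelSubgroup (↥(maximalRealSubfield L)) L (IsCMField.complexConj L) 2, ∀ g : (quasiSplit (↥(maximalRealSubfield L)) L (IsCMField.complexConj L) 2).Adelic, (eisensteinSeriesU (flatSectionU (fun _ : (quasiSplit (↥(maximalRealSubfield L)) L (IsCMField.complexConj L) 2).Adelic => φ₀) z)) (γ * g) = (eisensteinSeriesU (flatSectionU (fun _ : (quasiSplit (↥(maximalRealSubfield L)) L (IsCMField.complexConj L) 2).Adelic => φ₀) z)) g := fun γ hγ g =>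
    hφ γ ((quasiSplit (↥(maximalRealSubfield L)) L (IsCMField.complexConj L) 2).arithmeticSubgroup_le_quotientSubgroup (ratBorelSubgroup_le_arithmeticSubgroup (↥(maximalRealSubfield L)) L (IsCMField.complexConj L) 2 hγ)) g
  have hφm : Measurable (eisensteinSeriesU (flatSectionU (fun _ : (quasiSplit (↥(maximalRealSubfield L)) L (IsCMField.complexConj L) 2).Adelic => φ₀) z)) := (continuous_eisensteinSeriesU_flatSectionU_cm_two L hz (φ := fun _ : (quasiSplit (↥(maximalRealSubfield L)) L (IsCMField.complexConj L) 2).Adelic => φ₀) continuous_const (M := ‖φ₀‖) fun _ => le_rfl).measurable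
  -- the `Z`-lift of `E_z` and of its constant term are in `L²(wtm)`; the constant term is continuous
  have hφZ : MemLp (zFun (↥(maximalRealSubfield L)) L (IsCMField.complexConj L) 2 (eisensteinSeriesU (flatSectionU (fun _ : (quasiSplit (↥(maximalRealSubfield L)) L (IsCMField.complexConj L) 2).Adelic => φ₀) z))) 2 (weightedTruncMeasure (↥(maximalRealSubfield L)) L (IsCMField.complexConj L) 2 k a μZ) := memLp_zFun_of_iotaBound hb hφ hE
  have hψ2 : MemLp (zFun (↥(maximalRealSubfield L)) L (IsCMField.complexConj L) 2 (borelConstantTerm ν 𝓕 (eisensteinSeriesU (flatSectionU (fun _ : (quasiSplit (↥(maximalRealSubfield L)) L (IsCMField.complexConj L) 2).Adelic => φ₀) z)))) 2 (weightedTruncMeasure (↥(maximalRealSubfield L)) L (IsCMField.complexConj L) 2 k a μZ) := by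
    rw [hct, zFun_add, zFun_smul, zFun_smul]
    exact (hα₁.const_smul φ₀).add (hα₂.const_smul _)
  have hψc : Continuous (borelConstantTerm ν 𝓕 (eisensteinSeriesU (flatSectionU (fun _ : (quasiSplit (↥(maximalRealSubfield L)) L (IsCMField.complexConj L) 2).Adelic => φ₀) z))) := by
    rw [hct]
    exact ((continuous_borelHeight_cpow L z).const_smul φ₀).add ((continuous_borelHeight_cpow L (1 - z)).const_smul _)
  -- §1 compatibility, ★ P2b′, then linearity of `toHN` read a.e.
  rw [iota_toHX_eq_toHN hb hφ hE hφZ, cnstN_toHN_eq_toHN_borelConstantTerm' ν 𝓕 k a μZ h𝓕N hdis' hφm hφB hφZ hψ2 hψc]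
  refine Lp.ext ((coeFn_toHN (↥(maximalRealSubfield L)) L (IsCMField.complexConj L) 2 k a μZ _ hψ2).trans ?_)
  refine EventuallyEq.trans ?_ ((Lp.coeFn_add _ _).trans ((Lp.coeFn_smul _ _).add (Lp.coeFn_smul _ _))).symm
  filter_upwards [coeFn_toHN (↥(maximalRealSubfield L)) L (IsCMField.complexConj L) 2 k a μZ _ hα₁, coeFn_toHN (↥(maximalRealSubfield L)) L (IsCMField.complexConj L) 2 k a μZ _ hα₂] with x h₁ h₂
  rw [Pi.add_apply, Pi.smul_apply, Pi.smul_apply, h₁, h₂, hct, zFun_add, zFun_smul, zFun_smul]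
  rfl

end ConstantTerm

end Summit.HodgeConjecture.HodgeConjecture.Cruxes.H413.K2E1SphericalEisensteinCoefficientCMTwo

end
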